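import Mathlib
import Summits.Ventures.PercRepro2.Defs
import Summits.Ventures.PercRepro2.Harris
import Summits.Ventures.PercRepro2.Graph
import Summits.Ventures.PercRepro2.Events
import Summits.Ventures.PercRepro2.TReduction
import Summits.Ventures.PercRepro2.TReductionBase
import Summits.Ventures.PercRepro2.THAntipodalCoef
import Summits.Ventures.PercRepro2.THAntipodalPair
import Summits.Ventures.PercRepro2.THBaseEnum
import Summits.Ventures.PercRepro2.THClassVGraph
import Summits.Ventures.PercRepro2.THClassVEnum
import Summits.Ventures.PercRepro2.THClassVSliceA
import Summits.Ventures.PercRepro2.THClassVSliceB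
import Summits.Ventures.PercRepro2.THClassVSliceC
import Summits.Ventures.PercRepro2.THClassVSliceD

/-!
# (T_h) holds on the class-(v) graph at its tight pair, for every weight vector — although the
base-case hypothesis fails there (mine-a g50)

On the class-(v) graph `G₅` (`THClassVGraph`: root `r = 0`, hit vertex `h = 1`, edges `r–x₂, …,
r–x₆, h–x₂, h–x₃, x₂–x₄, x₂–x₅, x₃–x₆`) with the up-sets `𝓤 = {x₆ ∈ T}`, `𝓥 = {x₄, x₅ ∈ T}`, the
three events `Q = {h ∈ C_r}`, `U = {x₆ ∈ C_r}`, `e = {x₄, x₅ ∈ C_r}` satisfy the lane's three-event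
inequality (T_h)

  `P(Q ∩ U) P(e) + P(Q ∩ e) P(U) ≤ P(Q ∩ U ∩ e) + P(Q) P(U ∩ e)`

for EVERY admissible weight vector (`t_classV`, `t_classV_explicit`), while the antipodal base-case
hypothesis of `TReduction.tform_nonneg_of_base` FAILS: the main base case is `−2`
(`kform_univ_eq`, `not_base_nonneg`).  The proof is the antipodal-pair certificate of
`THAntipodalPair.tform_nonneg_of_antipodal_pair` with `κ = 1`: every proper pinned base case is
`≥ 0` (the kernel census of `THClassVSliceA`–`D` through `THClassVEnum.kform_eq_enum`,
`kform_nonneg_of_ne_univ`), the main base case is `−2 = −2κ`, and the two antipodal pinnings of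
the 4-cycle `r–x₄–x₂–x₅` (`r x₄` open, `r x₅` closed, `x₂ x₄` closed, `x₂ x₅` open, and the
reverse) have base case `1 = κ` — the tight case `2 min(K(a), K(ā)) = 2 = |K_E|` of MINE-A.md
§104.3.  Hence the class `𝓑` of graphs satisfying (T_h) termwise in the base cases is STRICTLY
smaller than the class `𝒯` of graphs satisfying (T_h): `G₅ ∈ 𝒯 ∖ 𝓑`.  No instance, no notation.
-/

namespace Summit.Ventures.PercRepro2

namespace THClassV

open Finset TReduction THBaseEnum THAntipodalPair

section Census

/-- A ten-entry vector at its entries. -/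
lemma vec_apply (f : Fin 10 → Fin 3) (x : Fin 10) :
    ![f 0, f 1, f 2, f 3, f 4, f 5, f 6, f 7, f 8, f 9] x = f x := by
  fin_cases x <;> rfl

/-- **The census**: the base case of every pinning pattern other than «every edge free» is
nonnegative (the slices `THClassVSliceA`–`D`). -/
theorem enum_nonneg (s0 s1 s2 s3 s4 s5 s6 s7 s8 s9 : Fin 3)
    (h : ∃ i, ![s0, s1, s2, s3, s4, s5, s6, s7, s8, s9] i ≠ 2) :
    0 ≤ enum s0 s1 s2 s3 s4 s5 s6 s7 s8 s9 := by
  rcases fin3_cases s0 with rfl | rfl | rfl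
  · rcases fin3_cases s1 with rfl | rfl | rfl
    · exact slice_0_0 s2 s3 s4 s5 s6 s7 s8 s9
    · exact slice_0_1 s2 s3 s4 s5 s6 s7 s8 s9
    · exact slice_0_2 s2 s3 s4 s5 s6 s7 s8 s9
  · rcases fin3_cases s1 with rfl | rfl | rfl
    · exact slice_1_0 s2 s3 s4 s5 s6 s7 s8 s9
    · exact slice_1_1 s2 s3 s4 s5 s6 s7 s8 s9
    · exact slice_1_2 s2 s3 s4 s5 s6 s7 s8 s9
  · rcases fin3_cases s1 with rfl | rfl | rfl
    · exact slice_2_0 s2 s3 s4 s5 s6 s7 s8 s9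
    · exact slice_2_1 s2 s3 s4 s5 s6 s7 s8 s9
    · rcases fin3_cases s2 with rfl | rfl | rfl
      · exact slice_22_0 s3 s4 s5 s6 s7 s8 s9
      · exact slice_22_1 s3 s4 s5 s6 s7 s8 s9
      · rcases fin3_cases s3 with rfl | rfl | rfl
        · exact slice_222_0 s4 s5 s6 s7 s8 s9
        · exact slice_222_1 s4 s5 s6 s7 s8 s9
        · rcases fin3_cases s4 with rfl | rfl | rfl
          · exact slice_2222_0 s5 s6 s7 s8 s9
          · exact slice_2222_1 s5 s6 s7 s8 s9
          · rcases fin3_cases s5 with rfl | rfl | rfl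
            · exact slice_22222_0 s6 s7 s8 s9
            · exact slice_22222_1 s6 s7 s8 s9
            · rcases fin3_cases s6 with rfl | rfl | rfl
              · exact slice_222222_0 s7 s8 s9
              · exact slice_222222_1 s7 s8 s9
              · rcases fin3_cases s7 with rfl | rfl | rfl
                · exact slice_2222222_0 s8 s9
                · exact slice_2222222_1 s8 s9
                · rcases fin3_cases s8 with rfl | rfl | rfl
                  · exact slice_22222222_0 s9
                  · exact slice_22222222_1 s9
                  · rcases fin3_cases s9 with rfl | rfl | rfl
                    · exact slice_222222222_0
                    · exact slice_222222222_1
                    · obtain ⟨i, hi⟩ := h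
                      exact absurd (by fin_cases i <;> rfl) hi

end Census

section Certificate

variable {R : Type*} [Field R] [LinearOrder R] [IsStrictOrderedRing R]

/-- **Every proper pinned base case is nonnegative** (`hprop` of the certificate). -/
theorem kform_nonneg_of_ne_univ (D : Finset (Fin 10)) (a : Fin 10 → R) (_ha₀ : IsProbVec a)
    (ha : ∀ x, x ∉ D → a x = 0 ∨ a x = 1) (hD : D ≠ univ) : 0 ≤ kform Q U e D a := by
  rw [kform_eq_enum D a ha]
  obtain ⟨x, -, hx⟩ := Finset.not_subset.1 fun h => hD (univ_subset_iff.1 h)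
  refine Int.cast_nonneg (enum_nonneg _ _ _ _ _ _ _ _ _ _ ⟨x, ?_⟩)
  rw [vec_apply]
  unfold stateOf
  rw [if_neg hx]
  split_ifs <;> decide

omit [IsStrictOrderedRing R] in
/-- The pattern of `(univ, a)` is «every edge free». -/
lemma stateOf_univ (a : Fin 10 → R) (i : Fin 10) : stateOf univ a i = 2 := by
  simp [stateOf]

omit [IsStrictOrderedRing R] in
/-- **The main base case is `−2`**: the base-case hypothesis fails on `G₅` at this pair. -/
theorem kform_univ_eq (a : Fin 10 → R) : kform Q U e univ a = -2 := by
  rw [kform_eq_enum univ a (fun x hx => absurd (mem_univ x) hx)]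
  simp only [stateOf_univ]
  rw [enum_main]
  norm_num

/-- **`G₅ ∉ 𝓑`**: the antipodal base cases are NOT all nonnegative at this pair. -/
theorem not_base_nonneg :
    ¬ ∀ (D : Finset (Fin 10)) (a : Fin 10 → R), IsProbVec a →
      (∀ x, x ∉ D → a x = 0 ∨ a x = 1) → 0 ≤ kform Q U e D a := by
  intro h
  have := h univ (fun _ => 0) ⟨fun _ => le_rfl, fun _ => zero_le_one⟩
    (fun x hx => absurd (mem_univ x) hx)
  rw [kform_univ_eq] at this
  norm_num at this

/-- The pinned edge set of the certificate: the 4-cycle `r–x₄–x₂–x₅` (edges `2, 3, 7, 8`). -/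
def S : Finset (Fin 10) := {2, 3, 7, 8}

/-- `S` is nonempty. -/
lemma S_nonempty : S.Nonempty := by decide

/-- The certificate pinning: `r x₄` and `x₂ x₅` open (edges `2`, `8`), `r x₅` and `x₂ x₄`
closed. -/
def certA : Config (Fin 10) := fun x => decide (x = 2 ∨ x = 8)

/-- The pattern of a `pinA` base case. -/
lemma stateOf_pinA (D : Finset (Fin 10)) (a : Config (Fin 10)) (x : Fin 10) :
    stateOf D (pinA a : Fin 10 → R) x = if x ∈ D then 2 else if a x then 1 else 0 := by
  unfold stateOf pinA
  by_cases hx : x ∈ D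
  · simp [hx]
  · cases a x <;> simp [hx]

/-- The pattern of the certificate pinning. -/
lemma stateOf_cert : stateOf (univ \ S) (pinA certA : Fin 10 → R) = ![2, 2, 1, 0, 2, 2, 2, 0, 1, 2] := by
  funext i
  rw [stateOf_pinA]
  fin_cases i <;> decide

/-- The pattern of the antipodal pinning. -/
lemma stateOf_cert' :
    stateOf (univ \ S) (pinA fun x => !certA x : Fin 10 → R) = ![2, 2, 0, 1, 2, 2, 2, 1, 0, 2] := by
  funext i
  rw [stateOf_pinA]
  fin_cases i <;> decide

/-- The base case of the certificate pinning is `1`. -/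
theorem kform_cert : kform Q U e (univ \ S) (pinA certA : Fin 10 → R) = 1 := by
  rw [kform_eq_enum _ _ (fun x _ => pinA_zero_or_one certA x), stateOf_cert]
  show ((enum 2 2 1 0 2 2 2 0 1 2 : ℤ) : R) = 1
  rw [enum_cert]
  norm_num

/-- The base case of the antipodal pinning is `1`. -/
theorem kform_cert' : kform Q U e (univ \ S) (pinA fun x => !certA x : Fin 10 → R) = 1 := by
  rw [kform_eq_enum _ _ (fun x _ => pinA_zero_or_one _ x), stateOf_cert']
  show ((enum 2 2 0 1 2 2 2 1 0 2 : ℤ) : R) = 1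
  rw [enum_cert']
  norm_num

/-- **THEOREM.** (T_h) holds on the class-(v) graph at the pair `({x₆ ∈ T}, {x₄, x₅ ∈ T})` for
every admissible weight vector: `P(Q ∩ U) P(e) + P(Q ∩ e) P(U) ≤ P(Q ∩ U ∩ e) + P(Q) P(U ∩ e)`. -/
theorem t_classV (p : Fin 10 → R) (hp : IsProbVec p) :
    prob p (Q ∩ U) * prob p e + prob p (Q ∩ e) * prob p U ≤
      prob p (Q ∩ U ∩ e) + prob p Q * prob p (U ∩ e) := by
  refine tform_nonneg_of_antipodal_pair Q U e S S_nonempty certA 1 zero_le_one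
    (fun D a₀ h₀ h₁ h₂ => kform_nonneg_of_ne_univ D a₀ h₀ h₁ h₂) ?_ ?_ ?_ p hp
  · rw [kform_univ_eq]; norm_num
  · rw [kform_cert]
  · rw [kform_cert']

/-- **THEOREM (explicit form).** (T_h) on `G₅` with `s = r = 0`, `h = 1`, `𝓤 = {x₆ ∈ T}`,
`𝓥 = {x₄, x₅ ∈ T}`, in the form of `THRefutation.not_t_general`: for every admissible `p`,
`P(Q ∩ U) P(e) + P(Q ∩ e) P(U) ≤ P(Q ∩ U ∩ e) + P(Q) P(U ∩ e)`. -/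
theorem t_classV_explicit (p : Fin 10 → R) (hp : IsProbVec p) :
    prob p (clusterInEvent ends 0 {T : Set (Fin 7) | (1 : Fin 7) ∈ T} ∩ clusterInEvent ends 0 𝓤)
        * prob p (clusterInEvent ends 0 𝓥)
      + prob p (clusterInEvent ends 0 {T : Set (Fin 7) | (1 : Fin 7) ∈ T} ∩ clusterInEvent ends 0 𝓥)
        * prob p (clusterInEvent ends 0 𝓤) ≤
      prob p (clusterInEvent ends 0 {T : Set (Fin 7) | (1 : Fin 7) ∈ T} ∩ clusterInEvent ends 0 𝓤
          ∩ clusterInEvent ends 0 𝓥)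
        + prob p (clusterInEvent ends 0 {T : Set (Fin 7) | (1 : Fin 7) ∈ T})
          * prob p (clusterInEvent ends 0 𝓤 ∩ clusterInEvent ends 0 𝓥) :=
  t_classV p hp

end Certificate

end THClassV

end Summit.Ventures.PercRepro2
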